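import Summits.ValiantsHypothesis.ValiantsHypothesis.Theorems.KPlusLogSqLawStaticPathSizeParity
import Summits.ValiantsHypothesis.ValiantsHypothesis.Theorems.KPlusLogSqLawStaticPathSweepChain
import Summits.ValiantsHypothesis.ValiantsHypothesis.Theorems.KPlusLogSqLawStaticPathMixedEventCrossings

/-!
# Route «KPlusLogSqLaw» — parametric max-weight independent set on a path: THEOREM T in the optimum's own currency — its SIZE changes at most `2n` times

HONEST FRAMING.  Helper toward the crux `WeakLifting` (item `stmt-ValiantsHypothesis-19561`, route `KPlusLogSqLaw`, cell `pub-symmetroid`,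
seat val-sym-lift-p4 g21, 2026-08-29) on the line of its witness-plan stub `stub_tridiagonalSectorB` (tropical twin of the STATIC tridiagonal
sector = parametric maximum-weight independent set on a path).  The chain-form corollary of THEOREM T (`…StaticPathMixedEvents.mixedEvents_card_le`,
val-sym-lift-p4 g14/g20; in the sweep's currency `…StaticPathMixedEventCrossings.mixed_eventCrossings_card_le`): with the parity lemma
`…StaticPathSizeParity.card_eq_card_iff_even_of_ne` (an event changes `|optimum|` iff its two indices have opposite parity),
(1) `exists_mixed_eventCrossing` — the sweep lemma `…StaticPathSweep.exists_event_crossing` with sizes: if the optimal independent sets at two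
generic parameters `θ < θ'` have different SIZES, some pair `p < q` with `p + q` odd crosses strictly in between at an event (induction on the
number of crossings in `(θ, θ')`, sampling between the first two cuts); (2) `sizeChain_le_card_mixedEventCrossings` — a chain of optimal sets at
strictly increasing generic parameters whose consecutive members have different sizes has at most as many steps as there are MIXED event crossings
strictly between its ends; (3) **`sizeChain_le_two_mul`** — hence, for prefix-sum lines with pairwise distinct slopes and pairwise distinct
crossing abscissae, ALONG ANY SWEEP THE SIZE OF THE MAXIMUM-WEIGHT INDEPENDENT SET CHANGES AT MOST `2n` TIMES (pair creations + annihilations of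
vacancies; the jump half of the ORDER QUESTION, stated about the optimum itself).  Statements about a path DP; nothing here asserts anything about
`WeakLifting`, `TropicalB`, `KPlusLogSqLaw`, the stub in its window, `MatrixDescartes` (stmt-ValiantsHypothesis-18050) or `VP ≠ VNP`; the same-parity
changes («hops») and the ORDER QUESTION (is the total number of changes `O(n)`?) stay open.
-/

set_option linter.dupNamespace false
set_option autoImplicit false

namespace Summit.ValiantsHypothesis.ValiantsHypothesis.Theorems.KPlusLogSqLaw

open Finset Classical

namespace StaticPathFold

noncomputable section

variable (w₁ w₀ : ℕ → ℝ)

/-! ## 1. The sweep with sizes: a change of size is carried by a MIXED event crossing -/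

/-- **EVERY CHANGE OF THE SIZE OF THE OPTIMUM IS CARRIED BY A MIXED EVENT CROSSING.**  Block `i+1, …, i+n`, prefix-sum lines `S_p(t) = A_p t + B_p`
(`A = altA (shift i w₁)`, `B = altB (shift i w₀)`); assume pairwise distinct crossing abscissae among non-parallel pairs (general position) and
pairwise distinct values at `θ < θ'`.  If optimal sets at `θ` and at `θ'` have different sizes, then some pair `p < q ≤ n` of non-parallel lines with
`p + q` ODD crosses at a parameter `τ ∈ (θ, θ')` at which `p` is the active index of the left fold just below `q` and `q` is a right record (the event
test of `…StaticPathEvents`, read at the crossing; the parity by `card_eq_card_iff_even_of_ne`). [folklore] -/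
theorem exists_mixed_eventCrossing {i n : ℕ} {θ' : ℝ}
    (hgen : ∀ p q p' q', p < q → q ≤ n → p' < q' → q' ≤ n → (p ≠ p' ∨ q ≠ q') →
      altA (shift i w₁) p ≠ altA (shift i w₁) q → altA (shift i w₁) p' ≠ altA (shift i w₁) q' →
      (altB (shift i w₀) q - altB (shift i w₀) p) / (altA (shift i w₁) p - altA (shift i w₁) q) ≠
        (altB (shift i w₀) q' - altB (shift i w₀) p') / (altA (shift i w₁) p' - altA (shift i w₁) q'))
    (hdis' : ∀ p q, p ≤ n → q ≤ n → p ≠ q →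
      L (altA (shift i w₁)) (altB (shift i w₀)) p θ' ≠ L (altA (shift i w₁)) (altB (shift i w₀)) q θ')
    {M' : Finset ℕ} (hM' : M' ∈ indepSets i n) (hopt' : ∑ t ∈ M', W w₁ w₀ t θ' = opt w₁ w₀ i n θ') :
    ∀ (m : ℕ) (θ : ℝ), θ < θ' →
      (∀ p q, p ≤ n → q ≤ n → p ≠ q → L (altA (shift i w₁)) (altB (shift i w₀)) p θ ≠ L (altA (shift i w₁)) (altB (shift i w₀)) q θ) →
      ((((range (n + 1)) ×ˢ (range (n + 1))).filter (fun pq : ℕ × ℕ => pq.1 < pq.2 ∧ altA (shift i w₁) pq.1 ≠ altA (shift i w₁) pq.2 ∧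
          θ < (altB (shift i w₀) pq.2 - altB (shift i w₀) pq.1) / (altA (shift i w₁) pq.1 - altA (shift i w₁) pq.2) ∧
          (altB (shift i w₀) pq.2 - altB (shift i w₀) pq.1) / (altA (shift i w₁) pq.1 - altA (shift i w₁) pq.2) < θ')).card ≤ m) →
      ∀ M : Finset ℕ, M ∈ indepSets i n → ∑ t ∈ M, W w₁ w₀ t θ = opt w₁ w₀ i n θ → M.card ≠ M'.card →
      ∃ p q, p < q ∧ q ≤ n ∧ altA (shift i w₁) p ≠ altA (shift i w₁) q ∧
        θ < (altB (shift i w₀) q - altB (shift i w₀) p) / (altA (shift i w₁) p - altA (shift i w₁) q) ∧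
        (altB (shift i w₀) q - altB (shift i w₀) p) / (altA (shift i w₁) p - altA (shift i w₁) q) < θ' ∧
        lab (altA (shift i w₁)) (altB (shift i w₀)) (q - 1)
            ((altB (shift i w₀) q - altB (shift i w₀) p) / (altA (shift i w₁) p - altA (shift i w₁) q)) = p ∧
        fold (altA (shift 0 (rev i n w₁))) (altB (shift 0 (rev i n w₀))) (n - q)
            ((altB (shift i w₀) q - altB (shift i w₀) p) / (altA (shift i w₁) p - altA (shift i w₁) q)) =
          L (altA (shift 0 (rev i n w₁))) (altB (shift 0 (rev i n w₀))) (n - q)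
            ((altB (shift i w₀) q - altB (shift i w₀) p) / (altA (shift i w₁) p - altA (shift i w₁) q)) ∧
        Odd (p + q) := by
  set A := altA (shift i w₁) with hAdef
  set B := altB (shift i w₀) with hBdef
  set τ : ℕ × ℕ → ℝ := fun pq => (B pq.2 - B pq.1) / (A pq.1 - A pq.2) with hτ
  intro m
  induction m using Nat.strong_induction_on with
  | _ m ih =>
  intro θ hθ hdis hcard M hM hopt hne
  set C := ((range (n + 1)) ×ˢ (range (n + 1))).filter
    (fun pq : ℕ × ℕ => pq.1 < pq.2 ∧ A pq.1 ≠ A pq.2 ∧ θ < τ pq ∧ τ pq < θ') with hC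
  have hmemC : ∀ pq : ℕ × ℕ, pq ∈ C ↔ pq.1 < pq.2 ∧ pq.2 ≤ n ∧ A pq.1 ≠ A pq.2 ∧ θ < τ pq ∧ τ pq < θ' := by
    intro pq
    rw [hC, mem_filter, mem_product, mem_range, mem_range]
    constructor
    · rintro ⟨⟨h1, h2⟩, h3, h4, h5, h6⟩; exact ⟨h3, by omega, h4, h5, h6⟩
    · rintro ⟨h3, h2, h4, h5, h6⟩; exact ⟨⟨by omega, by omega⟩, h3, h4, h5, h6⟩
  by_cases hCe : C = ∅
  · -- no crossing strictly between `θ` and `θ'`: the order is the same, so the optima agree (and so do their sizes)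
    exfalso
    have hMM' : M = M' := by
      refine eq_of_order w₁ w₀ hM hM' (unique_of_distinct w₁ w₀ hdis hM hopt) (unique_of_distinct w₁ w₀ hdis' hM' hopt') ?_
      intro p q hp hq
      by_cases hApq : A p = A q
      · exact L_lt_iff_of_parallel A B hApq θ θ'
      · -- the crossing abscissa is not in `[θ, θ']`
        have key : ∀ p q, p < q → q ≤ n → A p ≠ A q → (τ (p, q) < θ ∨ θ' < τ (p, q)) := by
          intro p q hpq hqn hA
          by_contra hh
          push Not at hh
          obtain ⟨h1, h2⟩ := hh
          have hne1 : τ (p, q) ≠ θ := by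
            intro he
            apply hdis p q (by omega) hqn (Nat.ne_of_lt hpq)
            have := L_eq_at_crossing A B hA
            simp only [hτ] at he
            rw [he] at this
            exact this
          have hne2 : τ (p, q) ≠ θ' := by
            intro he
            apply hdis' p q (by omega) hqn (Nat.ne_of_lt hpq)
            have := L_eq_at_crossing A B hA
            simp only [hτ] at he
            rw [he] at this
            exact this
          have hin : (p, q) ∈ C := (hmemC (p, q)).mpr ⟨hpq, hqn, hA, lt_of_le_of_ne h1 (Ne.symm hne1), lt_of_le_of_ne h2 hne2⟩
          rw [hCe] at hin
          exact absurd hin (notMem_empty _)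
        rcases lt_trichotomy p q with hpq | rfl | hpq
        · exact L_lt_iff_of_notMem A B hApq hθ.le (key p q hpq hq hApq)
        · exact absurd rfl hApq
        · have k2 := key q p hpq hp (Ne.symm hApq)
          rw [show τ (q, p) = (B p - B q) / (A q - A p) from rfl, crossing_symm A B] at k2
          exact L_lt_iff_of_notMem A B hApq hθ.le k2
    exact hne (by rw [hMM'])
  · -- the first crossing after `θ`
    have hCne : C.Nonempty := nonempty_iff_ne_empty.mpr hCe
    obtain ⟨ak, hakC, hakmin⟩ := exists_min_image C τ hCne
    obtain ⟨hak1, hak2, hakA, hakθ, hakθ'⟩ := (hmemC ak).mp hakC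
    set a := ak.1 with ha
    set k := ak.2 with hk
    -- the next cut: the least crossing abscissa after `τ ak`, or `θ'`
    set C₂ := C.erase ak with hC₂
    set T₂ : Finset ℝ := insert θ' (C₂.image τ) with hT₂
    have hT₂ne : T₂.Nonempty := ⟨θ', mem_insert_self _ _⟩
    set t₂ := T₂.min' hT₂ne with ht₂
    have ht₂θ' : t₂ ≤ θ' := min'_le _ _ (mem_insert_self _ _)
    have ht₂C : ∀ pq ∈ C₂, t₂ ≤ τ pq := fun pq hpq => min'_le _ _ (mem_insert_of_mem (mem_image_of_mem τ hpq))
    -- every other crossing in `(θ, θ')` is strictly later than `τ ak` (distinct abscissae)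
    have hlater : ∀ pq ∈ C₂, τ ak < τ pq := by
      intro pq hpq
      rw [hC₂, mem_erase] at hpq
      obtain ⟨hpq1, hpq2, hpqA, -, -⟩ := (hmemC pq).mp hpq.2
      refine lt_of_le_of_ne (hakmin pq hpq.2) ?_
      have hneq : ak.1 ≠ pq.1 ∨ ak.2 ≠ pq.2 := by
        by_contra hh; push Not at hh; exact hpq.1 (Prod.ext hh.1 hh.2).symm
      exact hgen ak.1 ak.2 pq.1 pq.2 hak1 hak2 hpq1 hpq2 hneq hakA hpqA
    have ht₂gt : τ ak < t₂ := by
      have hmem := min'_mem T₂ hT₂ne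
      rw [← ht₂, hT₂, mem_insert, mem_image] at hmem
      rcases hmem with h | ⟨pq, hpq, h⟩
      · rw [h]; exact hakθ'
      · rw [← h]; exact hlater pq hpq
    -- the sample point between the first two cuts
    set s := (τ ak + t₂) / 2 with hs
    have hs1 : τ ak < s := by rw [hs]; linarith
    have hs2 : s < t₂ := by rw [hs]; linarith
    have hθs : θ < s := hakθ.trans hs1
    have hsθ' : s < θ' := lt_of_lt_of_le hs2 ht₂θ'
    -- no crossing other than `ak` in `(θ, s]`; none at all in `(τ ak, s]`
    have hnoX : ∀ p q, p < q → q ≤ n → A p ≠ A q → (p, q) ≠ ak → (τ (p, q) < θ ∨ s < τ (p, q)) ∨ τ (p, q) = θ := by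
      intro p q hpq hqn hA hne'
      by_cases h1 : τ (p, q) ≤ θ
      · rcases h1.lt_or_eq with h | h
        · exact Or.inl (Or.inl h)
        · exact Or.inr h
      · by_cases h2 : τ (p, q) < θ'
        · have hin : (p, q) ∈ C₂ := by
            rw [hC₂, mem_erase]; exact ⟨hne', (hmemC (p, q)).mpr ⟨hpq, hqn, hA, not_le.mp h1, h2⟩⟩
          exact Or.inl (Or.inr (lt_of_lt_of_le hs2 (ht₂C _ hin)))
        · exact Or.inl (Or.inr (lt_of_lt_of_le hsθ' (not_lt.mp h2)))
    -- values at `θ` are distinct, so no crossing sits exactly at `θ`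
    have hnotθ : ∀ p q, p < q → q ≤ n → A p ≠ A q → τ (p, q) ≠ θ := by
      intro p q hpq hqn hA he
      apply hdis p q (by omega) hqn (Nat.ne_of_lt hpq)
      have := L_eq_at_crossing A B hA
      simp only [hτ] at he
      rw [he] at this
      exact this
    -- comparisons: every pair other than `ak` keeps its order on `[θ, s]`, and on `[θ, τ ak]`
    have hordS : ∀ (t : ℝ), θ ≤ t → t ≤ s → ∀ p q, p ≤ n → q ≤ n → ¬(p = a ∧ q = k) → ¬(p = k ∧ q = a) →
        (L A B p θ < L A B q θ ↔ L A B p t < L A B q t) := by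
      intro t hθt hts p q hp hq h1 h2
      by_cases hApq : A p = A q
      · exact L_lt_iff_of_parallel A B hApq θ t
      rcases lt_trichotomy p q with hpq | rfl | hpq
      · have hne' : (p, q) ≠ ak := fun he => h1 ⟨congrArg Prod.fst he, congrArg Prod.snd he⟩
        rcases hnoX p q hpq hq hApq hne' with (h | h) | h
        · exact L_lt_iff_of_notMem A B hApq hθt (Or.inl h)
        · exact L_lt_iff_of_notMem A B hApq hθt (Or.inr (lt_of_le_of_lt hts h))
        · exact absurd h (hnotθ p q hpq hq hApq)
      · exact absurd rfl hApq
      · have hne' : (q, p) ≠ ak := fun he => h2 ⟨congrArg Prod.snd he, congrArg Prod.fst he⟩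
        rcases hnoX q p hpq hp (Ne.symm hApq) hne' with (h | h) | h
        · rw [show τ (q, p) = (B p - B q) / (A q - A p) from rfl, crossing_symm A B] at h
          exact L_lt_iff_of_notMem A B hApq hθt (Or.inl h)
        · rw [show τ (q, p) = (B p - B q) / (A q - A p) from rfl, crossing_symm A B] at h
          exact L_lt_iff_of_notMem A B hApq hθt (Or.inr (lt_of_le_of_lt hts h))
        · exact absurd h (hnotθ q p hpq hp (Ne.symm hApq))
    have hdisS : ∀ p q, p ≤ n → q ≤ n → p ≠ q → L A B p s ≠ L A B q s := by
      intro p q hp hq hpq heq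
      by_cases hApq : A p = A q
      · -- parallel distinct lines never meet
        apply hdis p q hp hq hpq
        have := (L_lt_iff_of_parallel A B hApq θ s)
        have h2 := (L_lt_iff_of_parallel A B (hApq.symm) θ s)
        rcases lt_trichotomy (L A B p θ) (L A B q θ) with h | h | h
        · exact absurd (this.mp h) (by rw [heq]; exact lt_irrefl _)
        · exact h
        · exact absurd (h2.mp h) (by rw [heq]; exact lt_irrefl _)
      · -- a non-parallel pair meets only at its crossing abscissa, which is not `s`
        have key : ∀ p q, p < q → q ≤ n → A p ≠ A q → L A B p s = L A B q s → False := by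
          intro p q hpq hqn hA heq
          have hsx : s = τ (p, q) := by
            have h1 := L_lt_iff_sign A B hA s
            have h2 := L_lt_iff_sign A B (Ne.symm hA) s
            rw [crossing_symm A B] at h2
            have e1 : ¬ (A p - A q) * (s - τ (p, q)) < 0 := fun h => absurd (h1.mpr h) (by rw [heq]; exact lt_irrefl _)
            have e2 : ¬ (A q - A p) * (s - τ (p, q)) < 0 := fun h => absurd (h2.mpr h) (by rw [heq]; exact lt_irrefl _)
            have hu : A p - A q ≠ 0 := sub_ne_zero.mpr hA
            by_contra hsne
            have hsne' : s - τ (p, q) ≠ 0 := sub_ne_zero.mpr hsne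
            rcases (mul_ne_zero hu hsne').lt_or_gt with h | h
            · exact e1 h
            · apply e2; nlinarith
          by_cases hpqak : (p, q) = ak
          · rw [hpqak] at hsx; linarith
          · rcases hnoX p q hpq hqn hA hpqak with (h | h) | h
            · linarith
            · linarith
            · exact hnotθ p q hpq hqn hA h
        rcases lt_trichotomy p q with h | rfl | h
        · exact key p q h hq hApq heq
        · exact hpq rfl
        · exact key q p h hp (Ne.symm hApq) heq.symm
    obtain ⟨Ms, hMs, hMsopt⟩ := exists_opt_eq w₁ w₀ i n s
    by_cases hch : M.card = Ms.card
    · -- no change of size up to `s`: recurse on `(s, θ')`, which has fewer crossings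
      have hcard' : (((range (n + 1)) ×ˢ (range (n + 1))).filter (fun pq : ℕ × ℕ => pq.1 < pq.2 ∧ A pq.1 ≠ A pq.2 ∧
          s < τ pq ∧ τ pq < θ')).card < m := by
        refine lt_of_lt_of_le ?_ hcard
        apply card_lt_card
        rw [ssubset_iff_of_subset]
        · refine ⟨ak, hakC, ?_⟩
          rw [mem_filter]; push Not; intro _ _ _ h; exact absurd (hs1.trans h) (lt_irrefl _)
        · intro pq hpq
          rw [mem_filter] at hpq
          rw [hC, mem_filter]
          exact ⟨hpq.1, hpq.2.1, hpq.2.2.1, hθs.trans hpq.2.2.2.1, hpq.2.2.2.2⟩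
      obtain ⟨p, q, hpq, hqn, hA, h1, h2, hev⟩ :=
        ih _ hcard' s hsθ' hdisS le_rfl Ms hMs hMsopt.symm (fun h => hne (hch.trans h))
      exact ⟨p, q, hpq, hqn, hA, hθs.trans h1, h2, hev⟩
    · -- the size changes across the single crossing `ak`: it is an event (test of `…StaticPathEvents`), read at `τ ak`, and a MIXED one
      have hchne : M ≠ Ms := fun h => hch (by rw [h])
      have hadj : ∀ x, x ≤ n → x ≠ a → x ≠ k → (L A B x θ < L A B a θ ↔ L A B x θ < L A B k θ) := by
        intro x hx hxa hxk
        -- compare at `τ ak`, where `S a = S k`, and transfer back to `θ`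
        have e1 := hordS (τ ak) hakθ.le hs1.le x a hx (by omega) (fun h => hxa h.1) (fun h => hxk h.1)
        have e2 := hordS (τ ak) hakθ.le hs1.le x k hx hak2 (fun h => hxa h.1) (fun h => hxk h.1)
        rw [e1, e2, show L A B a (τ ak) = L A B k (τ ak) from L_eq_at_crossing A B hakA]
      have hev := (ne_iff_event w₁ w₀ hak1 hak2 hM hMs (unique_of_distinct w₁ w₀ hdis hM hopt)
        (unique_of_distinct w₁ w₀ hdisS hMs hMsopt.symm) (fun p q hp hq h1 h2 => hordS s hθs.le le_rfl p q hp hq h1 h2)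
        hdis hdisS hadj).mp hchne
      obtain ⟨-, hL, hMid, hR⟩ := hev
      have hlab : lab A B (k - 1) θ = a := (lab_pred_eq_iff A B hak1 θ).mpr ⟨hL, hMid⟩
      have htr := (event_iff_of_order w₁ w₀ hak1 hak2 (τ := τ ak)
        (fun p q hp hq h1 h2 => hordS (τ ak) hakθ.le hs1.le p q hp hq h1 h2)).mp ⟨hlab, hR⟩
      have hodd : Odd (a + k) := by
        rcases Nat.even_or_odd (a + k) with he | ho
        · exact absurd ((card_eq_card_iff_even_of_ne w₁ w₀ hak1 hak2 hM hMs (unique_of_distinct w₁ w₀ hdis hM hopt)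
            (unique_of_distinct w₁ w₀ hdisS hMs hMsopt.symm) (fun p q hp hq h1 h2 => hordS s hθs.le le_rfl p q hp hq h1 h2)
            hdis hdisS hadj hchne).mpr he) hch
        · exact ho
      exact ⟨a, k, hak1, hak2, hakA, hakθ, hakθ', htr.1, htr.2, hodd⟩

/-! ## 2. Chains of size changes are no longer than the number of mixed event crossings they span -/

/-- **CHAINS OF SIZE CHANGES ARE NO LONGER THAN THE NUMBER OF MIXED EVENT CROSSINGS THEY SPAN.** [folklore] -/
theorem sizeChain_le_card_mixedEventCrossings (i n N : ℕ) (θs : Fin (N + 1) → ℝ) (hθ : StrictMono θs) (Ms : Fin (N + 1) → Finset ℕ)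
    (hgen : ∀ p q p' q', p < q → q ≤ n → p' < q' → q' ≤ n → (p ≠ p' ∨ q ≠ q') →
      altA (shift i w₁) p ≠ altA (shift i w₁) q → altA (shift i w₁) p' ≠ altA (shift i w₁) q' →
      (altB (shift i w₀) q - altB (shift i w₀) p) / (altA (shift i w₁) p - altA (shift i w₁) q) ≠
        (altB (shift i w₀) q' - altB (shift i w₀) p') / (altA (shift i w₁) p' - altA (shift i w₁) q'))
    (hmem : ∀ k, Ms k ∈ indepSets i n)
    (hopt : ∀ k, ∑ t ∈ Ms k, W w₁ w₀ t (θs k) = opt w₁ w₀ i n (θs k))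
    (hdis : ∀ k, ∀ p q, p ≤ n → q ≤ n → p ≠ q →
      L (altA (shift i w₁)) (altB (shift i w₀)) p (θs k) ≠ L (altA (shift i w₁)) (altB (shift i w₀)) q (θs k))
    (hch : ∀ e : Fin N, (Ms e.castSucc).card ≠ (Ms e.succ).card) :
    N ≤ (((range (n + 1)) ×ˢ (range (n + 1))).filter (fun pq : ℕ × ℕ => pq.1 < pq.2 ∧
        altA (shift i w₁) pq.1 ≠ altA (shift i w₁) pq.2 ∧
        θs 0 < (altB (shift i w₀) pq.2 - altB (shift i w₀) pq.1) / (altA (shift i w₁) pq.1 - altA (shift i w₁) pq.2) ∧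
        (altB (shift i w₀) pq.2 - altB (shift i w₀) pq.1) / (altA (shift i w₁) pq.1 - altA (shift i w₁) pq.2) < θs (Fin.last N) ∧
        lab (altA (shift i w₁)) (altB (shift i w₀)) (pq.2 - 1)
            ((altB (shift i w₀) pq.2 - altB (shift i w₀) pq.1) / (altA (shift i w₁) pq.1 - altA (shift i w₁) pq.2)) = pq.1 ∧
        fold (altA (shift 0 (rev i n w₁))) (altB (shift 0 (rev i n w₀))) (n - pq.2)
            ((altB (shift i w₀) pq.2 - altB (shift i w₀) pq.1) / (altA (shift i w₁) pq.1 - altA (shift i w₁) pq.2)) =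
          L (altA (shift 0 (rev i n w₁))) (altB (shift 0 (rev i n w₀))) (n - pq.2)
            ((altB (shift i w₀) pq.2 - altB (shift i w₀) pq.1) / (altA (shift i w₁) pq.1 - altA (shift i w₁) pq.2)) ∧
        Odd (pq.1 + pq.2))).card := by
  set A := altA (shift i w₁) with hAdef
  set B := altB (shift i w₀) with hBdef
  set τ : ℕ × ℕ → ℝ := fun pq => (B pq.2 - B pq.1) / (A pq.1 - A pq.2) with hτ
  -- one mixed event crossing inside each step
  have key : ∀ e : Fin N, ∃ pq : ℕ × ℕ, pq.1 < pq.2 ∧ pq.2 ≤ n ∧ A pq.1 ≠ A pq.2 ∧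
      θs e.castSucc < τ pq ∧ τ pq < θs e.succ ∧
      lab A B (pq.2 - 1) (τ pq) = pq.1 ∧
      fold (altA (shift 0 (rev i n w₁))) (altB (shift 0 (rev i n w₀))) (n - pq.2) (τ pq) =
        L (altA (shift 0 (rev i n w₁))) (altB (shift 0 (rev i n w₀))) (n - pq.2) (τ pq) ∧
      Odd (pq.1 + pq.2) := by
    intro e
    have hlt : θs e.castSucc < θs e.succ := hθ (Fin.castSucc_lt_succ)
    obtain ⟨p, q, hpq, hqn, hA, h1, h2, hl, hr, ho⟩ :=
      exists_mixed_eventCrossing w₁ w₀ (n := n) hgen (hdis e.succ) (hmem e.succ) (hopt e.succ) _ (θs e.castSucc) hlt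
        (hdis e.castSucc) le_rfl (Ms e.castSucc) (hmem e.castSucc) (hopt e.castSucc) (hch e)
    exact ⟨(p, q), hpq, hqn, hA, h1, h2, hl, hr, ho⟩
  choose f hf using key
  -- distinct steps have disjoint parameter intervals, so `f` is injective
  have hinj : Function.Injective f := by
    intro e e' hee'
    by_contra hne
    obtain ⟨-, -, -, h1, h2, -, -, -⟩ := hf e
    obtain ⟨-, -, -, h1', h2', -, -, -⟩ := hf e'
    rw [hee'] at h1 h2
    rcases lt_or_gt_of_ne hne with hlt | hlt
    · have h3 : θs e.succ ≤ θs e'.castSucc :=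
        hθ.monotone (Fin.le_iff_val_le_val.mpr (by rw [Fin.val_succ, Fin.val_castSucc]; exact hlt))
      linarith
    · have h3 : θs e'.succ ≤ θs e.castSucc :=
        hθ.monotone (Fin.le_iff_val_le_val.mpr (by rw [Fin.val_succ, Fin.val_castSucc]; exact hlt))
      linarith
  -- and its image lies in the set of mixed event crossings spanned by the chain
  have himg : ∀ e ∈ (univ : Finset (Fin N)), f e ∈ ((range (n + 1)) ×ˢ (range (n + 1))).filter (fun pq : ℕ × ℕ =>
      pq.1 < pq.2 ∧ A pq.1 ≠ A pq.2 ∧ θs 0 < τ pq ∧ τ pq < θs (Fin.last N) ∧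
      lab A B (pq.2 - 1) (τ pq) = pq.1 ∧
      fold (altA (shift 0 (rev i n w₁))) (altB (shift 0 (rev i n w₀))) (n - pq.2) (τ pq) =
        L (altA (shift 0 (rev i n w₁))) (altB (shift 0 (rev i n w₀))) (n - pq.2) (τ pq) ∧
      Odd (pq.1 + pq.2)) := by
    intro e _
    obtain ⟨hpq, hqn, hA, h1, h2, hl, hr, ho⟩ := hf e
    rw [mem_filter, mem_product, mem_range, mem_range]
    have h0 : θs 0 ≤ θs e.castSucc := hθ.monotone (Fin.zero_le _)
    have hN : θs e.succ ≤ θs (Fin.last N) := hθ.monotone (Fin.le_last _)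
    exact ⟨⟨by omega, by omega⟩, hpq, hA, lt_of_le_of_lt h0 h1, lt_of_lt_of_le h2 hN, hl, hr, ho⟩
  have hcard := card_le_card_of_injOn f himg (fun e _ e' _ h => hinj h)
  rwa [card_univ, Fintype.card_fin] at hcard

/-! ## 3. THEOREM T in the optimum's currency -/

/-- **THE SIZE OF THE MAXIMUM-WEIGHT INDEPENDENT SET CHANGES AT MOST `2n` TIMES ALONG ANY SWEEP** (THEOREM T of val-sym-lift-p4 g14, kernel
`mixedEvents_card_le` of g20, read on the optimum).  Block of `n` items `i+1, …, i+n` with item lines `W t θ = w₁ t · θ + w₀ t`, whose signed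
prefix-sum lines have pairwise distinct slopes and pairwise distinct crossing abscissae (general position); then every chain of optimal independent
sets `M_0, …, M_N` at strictly increasing parameters `θ_0 < … < θ_N` (prefix-sum values pairwise distinct at each sample), in which consecutive sets
have DIFFERENT SIZES, has `N ≤ 2n`.  (Pair creations and annihilations of vacancies are linearly many; whether ALL changes — including the
vacancy hops — are `O(n)` is the open ORDER QUESTION.) [folklore] -/
theorem sizeChain_le_two_mul (i n N : ℕ) (θs : Fin (N + 1) → ℝ) (hθ : StrictMono θs) (Ms : Fin (N + 1) → Finset ℕ)
    (hslope : ∀ p q, p ≤ n → q ≤ n → p ≠ q → altA (shift i w₁) p ≠ altA (shift i w₁) q)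
    (hgen : ∀ p q p' q', p < q → q ≤ n → p' < q' → q' ≤ n → (p ≠ p' ∨ q ≠ q') →
      altA (shift i w₁) p ≠ altA (shift i w₁) q → altA (shift i w₁) p' ≠ altA (shift i w₁) q' →
      (altB (shift i w₀) q - altB (shift i w₀) p) / (altA (shift i w₁) p - altA (shift i w₁) q) ≠
        (altB (shift i w₀) q' - altB (shift i w₀) p') / (altA (shift i w₁) p' - altA (shift i w₁) q'))
    (hmem : ∀ k, Ms k ∈ indepSets i n)
    (hopt : ∀ k, ∑ t ∈ Ms k, W w₁ w₀ t (θs k) = opt w₁ w₀ i n (θs k))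
    (hdis : ∀ k, ∀ p q, p ≤ n → q ≤ n → p ≠ q →
      L (altA (shift i w₁)) (altB (shift i w₀)) p (θs k) ≠ L (altA (shift i w₁)) (altB (shift i w₀)) q (θs k))
    (hch : ∀ e : Fin N, (Ms e.castSucc).card ≠ (Ms e.succ).card) :
    N ≤ 2 * n := by
  -- no third prefix-sum line through a crossing: it would share the crossing abscissa
  have hgp : ∀ p q t, p ≤ n → q ≤ n → t ≤ n → p ≠ q → t ≠ p → t ≠ q →
      L (altA (shift i w₁)) (altB (shift i w₀)) t
          ((altB (shift i w₀) q - altB (shift i w₀) p) / (altA (shift i w₁) p - altA (shift i w₁) q)) ≠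
        L (altA (shift i w₁)) (altB (shift i w₀)) p
          ((altB (shift i w₀) q - altB (shift i w₀) p) / (altA (shift i w₁) p - altA (shift i w₁) q)) := by
    intro p q t hp hq ht hpq htp htq heq
    set A := altA (shift i w₁) with hAdef
    set B := altB (shift i w₀) with hBdef
    have hApt : A p ≠ A t := hslope p t hp ht (Ne.symm htp)
    have hApq : A p ≠ A q := hslope p q hp hq hpq
    have hx : (B q - B p) / (A p - A q) = (B t - B p) / (A p - A t) := eq_crossing_of_L_eq A B hApt heq.symm
    rcases lt_or_gt_of_ne hpq with hpq' | hpq'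
    · rcases lt_or_gt_of_ne htp with htp' | htp'
      · -- t < p < q
        have h := hgen t p p q htp' hp hpq' hq (Or.inl htp) (Ne.symm hApt) hApq
        rw [crossing_symm A B p t] at h
        exact h hx.symm
      · -- p < t, p < q, t ≠ q
        exact hgen p q p t hpq' hq htp' ht (Or.inr (Ne.symm htq)) hApq hApt hx
    · rcases lt_or_gt_of_ne htp with htp' | htp'
      · -- t < p, q < p
        have h := hgen t p q p htp' hp hpq' hp (Or.inl htq) (Ne.symm hApt) (Ne.symm hApq)
        rw [crossing_symm A B p t, crossing_symm A B p q] at h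
        exact h hx.symm
      · -- q < p < t
        have h := hgen q p p t hpq' hp htp' ht (Or.inl (Ne.symm hpq)) (Ne.symm hApq) hApt
        rw [crossing_symm A B p q] at h
        exact h hx
  exact (sizeChain_le_card_mixedEventCrossings w₁ w₀ i n N θs hθ Ms hgen hmem hopt hdis hch).trans
    (mixed_eventCrossings_card_le w₁ w₀ i n (θs 0) (θs (Fin.last N)) hslope hgp)

end

end StaticPathFold

end Summit.ValiantsHypothesis.ValiantsHypothesis.Theorems.KPlusLogSqLaw
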